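import Summits.BirchSwinnertonDyer.Rank1Residual.X10.ClassX10bLeaf
import Summits.BirchSwinnertonDyer.BirchSwinnertonDyer.Theorems.SmallImageMuTransferMuTransferStubX9MuBookkeeping
import Literature.NumberTheory.EllipticCurves.Kato2004.EulerSystemClasses
import Literature.NumberTheory.EllipticCurves.KatoFineSelmerFiniteProofs
import Literature.NumberTheory.EllipticCurves.SelmerInftyTorsionFiniteProofs
import Literature.NumberTheory.EllipticCurves.PAdicBSDProofs
import Literature.NumberTheory.EllipticCurves.TateModuleContinuityProofs
import Literature.NumberTheory.EllipticCurves.ModPImageScalarThreeProofs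
import HarnessLib

/-!
# Class X10b = N2 (`p = 3` good ordinary, `E[3]` irreducible, `ρ̄_{E,3}` NOT surjective): the
# `μ`-transfer node `KatoMuTransferThree` REDUCED, in the kernel, to Kato's two PUBLISHED construction
# facts and ONE typed core — the `p = 3` twin of the registered skeleton of crux `MuTransferX9`
# (rung K6, route `SmallImageMuTransfer`, item 19276, skeleton v4 sha16 0154dd5daf38efd6, cell
# `bsd-smallim`) — and the A5 class leaf behind it (cell `b2b-bsdres`, unit `b2b-bsdres-x10` = N2
# class lead, GEN 36; ONE typed node + theorems; nothing asserted, nothing booked)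

HONEST FRAMING (run/shared/lean/b2b/bsd-rank1-residual/, verbatim in every file): the goal of the
cell is to DELETE the COMBINATION-SHAPED residual classes of the Birch–Swinnerton-Dyer formula for
ALL analytic-rank `≤ 1` elliptic curves over `ℚ` — "full BSD formula for every rank `≤ 1` curve in
class `C`" assembled STRICTLY from published theorems — so that the rank-`≤ 1` remainder becomes
exactly the CONSTRUCTION-SHAPED classes, which are TYPED (missing-input `Prop`s), NOT attempted.
This is not "finishing BSD". Class X10b (N2) keeps its label CONSTRUCTION-SHAPED / NEEDS X_A3
(RESIDUAL-MAP §I N2); nothing is booked by this file; no census number moves.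

## What (x10 GEN 36, X10-AUDIT §42)

Row A5 of the BSD ladder (rung K6) has the class leaf `BSDpOnClassX10b` with the kernel bridge
`bsdpOnClassX10b_of_katoMuTransferThree` (GEN 35, `X10/ClassX10bLeaf`): A5 ⟸ `KatoMuTransferThree` ∧
`AnalyticMuZeroOnClassX10b` ∧ Schneider-on-rank-1 ∧ PUBLISHED facts (incl. the flagged rational main
conjecture at `3`). `KatoMuTransferThree` (cell `bsd-smallim`, p407527) is the `p = 3` case of the
`μ`-transfer, an `@[conjecture]` OBLIGATION NODE recording the cell theorem MU-TRANSFER-PROOF Cor. B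
(KOLY-MEMO Cor. 5.7.2) at `p = 3` (its §7 (ii): "all steps hold verbatim PROVIDED `3 ∤ #Ḡ` (X10b images
3Ns/3Nn: `−1 ∈ Ḡ` for (F2)/(F8) …)"). For the X9 twin (`p ∈ {5,7}`) the route `SmallImageMuTransfer`
has meanwhile REDUCED the transfer, in the kernel, to exactly two PUBLISHED construction facts of Kato
2004 and ONE open core (registered skeleton v4 of crux `MuTransferX9`, seat `bsd-smallim-k6-c2` g2,
composition `MuTransferX9_of` sorry-free): GV Prop. 3.7 (`L_p ∈ Λ`) → the certificate gives
`G₁ ∉ (p)` → Kato's §17.13 package with the fine quotient and the Thm. 12.6 span clause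
(`Kato2004.exists_divisibilityInputs_fineQuotient_zeta`) → a GENUINE `Λ`-adic Euler-system class
`s ∉ p𝐇¹` (`Kato2004.exists_isEulerSystemClass_not_mem`, §6 (i) of the proof) → THE CORE (Theorem A of
MU-TRANSFER-PROOF on genuine objects: some power of `T = γ − 1` kills the `E[p]`-lifts of
`Sel₀(ℚ_∞, E[p^∞])`) → `Sel₀(ℚ_∞, E[p^∞])[p]` finite → `X₀/pX₀` finite → `length_{(p)} X₀ = 0` →
`length_{(p)} X = 0` (Kato (14.9.3)/(17.13.1)) → `μ(X) = 0`. Every step of that chain except the core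
is stated and proved in the tree for an arbitrary ODD good ordinary prime. THIS FILE runs it at `p = 3`:

* `CoreTheoremAOnClassX10b` — the `p = 3` CORE as a typed `Prop` (`@[conjecture]`, nothing asserted):
  verbatim the registered `stub_coreX9` of skeleton v4 with the class hypothesis `ClassX9 W p` replaced
  by the hypotheses of `KatoMuTransferThree` (`p = 3`, good ordinary, `E[3]` irreducible, `ρ̄_{E,3}`
  not surjective). Its paper proof is MU-TRANSFER-PROOF §§1–5 at `p = 3`, whose only image inputs are
  `E[3]` absolutely irreducible, a non-trivial central SCALAR in `Ḡ` — at `p = 3` the scalar `−1`, now a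
  TREE THEOREM (`WeierstrassCurve.exists_galoisRepTorsion_eq_smul_of_not_surjective_three`, cell
  `bsd-smallim`, from Serre's Prop. 15: `3 ∤ #Ḡ` for a proper irreducible `Ḡ ≤ GL₂(𝔽₃)`) — and "no
  quotient of order `p`" of `Ḡ^{ab}`, `Ḡ ∩ SL₂(𝔽₃)` (`#Ḡ ∈ {8, 16}`); `C(q−1, 2) ≡ 0`, `2 ∈ Ω^×`,
  Kato 12.4 for `p ≠ 2` are as at `p ≥ 5`;
* `katoMuTransferThree_of_core` — KERNEL: `Kato2004.nonempty_iwasawaH1Data` ∧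
  `Kato2004.exists_divisibilityInputs_fineQuotient_zeta` (PUB, construction facts) ∧
  `CoreTheoremAOnClassX10b` ⟹ `KatoMuTransferThree` (the composition `MuTransferX9_of` at `p = 3`);
* `mazurMainConjectureOnClassX10b_of_core`, `bsdpOnClassX10b_of_core` — the A5 chain re-based on the
  core: X_A3 on the class and the class leaf `BSDpOnClassX10b` from the core ∧ the two construction
  facts ∧ `AnalyticMuZeroOnClassX10b` ∧ the Schneider rider ∧ PUBLISHED facts (incl. Yan–Zhu Thm. 4.9,
  flag `YZ26@3-BF-ERL-Ohta`, which rides with the conclusion).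

READING for N2 (evidence, no label moves): the open content of the class node `KatoMuTransferThree` is
now, in the kernel, EXACTLY the `p = 3` core `CoreTheoremAOnClassX10b` — the same finite-level
cohomological statement the route `SmallImageMuTransfer` is formalising for X9 (CORE-PLAN S0.1–S4.5 of
seat `bsd-smallim-k6-c2`), whose paper proof is image-generic under (F2); a kernel proof of
`stub_coreX9` written against "central scalar + `p ∤ #(Ḡ ∩ SL₂)`-quotients" ports to this node with
the scalar `−1`. Nothing here is a route item (director-bsd, PLAN-K6-v2 §5: "A5 twin leaf — default NO
separate route this cycle; K6′ finite-ρ̄ companion card when a planner half-hour is free"): this file is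
the K6′ crux composition in waiting. Where `3` enters: only through the hypothesis `p = 3` of the node
and of `KatoMuTransferThree`; every tree step used is stated for odd `p`.

References: [Kato2004Asterisque] §12.2 (12.2.1), Thm. 12.4, Thm. 12.6 (p. 222), Ex. 13.3, §13.8,
(14.9.3), §17.13 (pp. 279–280); [GreenbergVatsal2000] Prop. 3.7; [Rubin2000] Def. 2.1.1; [Serre1972]
Prop. 15, §2.6; [GreenbergLNM1716] Conj. 1.11; cell files X10-AUDIT.md §41–§42;
HOME/pub/bsd-smallim/koly/MU-TRANSFER-PROOF.md §§0–7; HOME/pub/bsd-smallim/plan/k6/lines/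
MuTransferX9_birth_v4_REGISTERED_0154dd5d.lean, MuTransferX9_CORE-PLAN_k6c2.md.
-/

set_option autoImplicit false

noncomputable section

open scoped Classical MatrixGroups ModularForm NumberField
open CongruenceSubgroup WeierstrassCurve Field IsDedekindDomain
open Literature.NumberTheory.GaloisRepresentations
open Literature.NumberTheory.EllipticCurves Literature.NumberTheory.EllipticCurves.ModularForms
open Literature.NumberTheory.EllipticCurves.Kato2004
open Literature.NumberTheory.EllipticCurves.Kato2004.EulerSystemValues
open Literature.NumberTheory.EllipticCurves.Rank1Residual
open Summit.BirchSwinnertonDyer.BirchSwinnertonDyer.Theorems.Rank1ResidualX1Defs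
open Summit.BirchSwinnertonDyer.BirchSwinnertonDyer.Rank1Residual

namespace Summit.BirchSwinnertonDyer.Rank1Residual.X10

/-! ### The `p = 3` core of the `μ`-transfer as a typed node -/

/-- **TYPED NODE — the CORE of Theorem A of MU-TRANSFER-PROOF (KOLY-MEMO Thm. 5.7.1) at `p = 3` on
X10b, on GENUINE objects (OPEN; the cell theorem on paper, §7 (ii); nothing asserted).** For a globally
minimal elliptic `W/ℚ` and `p = 3` with good ordinary reduction, `E[3]` irreducible and `ρ̄_{E,3}` NOT
surjective, the cyclotomic `(κ, γ)` and Kato's `𝐇¹_Γ(T_pW)` (`I`): if some GENUINE `Λ`-adic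
Euler-system class `s ∈ 𝐇¹` (`Kato2004.IsEulerSystemClass`) is not divisible by `p`, then there is
`J` such that the iterate `(conj_γ − id)^[J]` kills every `y ∈ H¹(ℚ_∞, E[p])`
(`subgroupH1 κ.kerSubgroup E[p]`) whose image in `H¹(ℚ_∞, E[p^∞])` (`torsionToPrimaryH1Sub`) lies in
`Sel₀(ℚ_∞, E[p^∞])` (`W.fineSelmerInfty κ`). Verbatim the registered `stub_coreX9` of crux
`MuTransferX9` (skeleton v4, sha16 0154dd5daf38efd6, seat `bsd-smallim-k6-c2` g2) with `ClassX9 W p`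
replaced by the hypotheses of `KatoMuTransferThree`. Paper proof: MU-TRANSFER-PROOF §§1–5 with
`J = 2e − 1 + ε′`; at `p = 3` its image inputs are the central scalar `−1 ∈ Ḡ` (tree theorem
`exists_galoisRepTorsion_eq_smul_of_not_surjective_three`) and `3 ∤ #Ḡ` (`#Ḡ ∈ {8,16}`: 3Ns/3Nn).
[cite: Kato2004Asterisque, Thm. 12.4, Thm. 12.6 (p. 222), §13.8 (p. 228) (shape only; nothing asserted)]
[cite: GreenbergLNM1716, §1 Conj. 1.11 (shape only; nothing asserted)] -/
@[conjecture] def CoreTheoremAOnClassX10b : Prop :=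
  ∀ (W : WeierstrassCurve ℚ) [W.IsElliptic] [W.IsGloballyMinimal] (p : ℕ) [Fact p.Prime]
    [ContinuousSMul ℤ_[p] (W.tateModule p)] [Module.Free ℤ_[p] (W.tateModule p)]
    [Module.Finite ℤ_[p] (W.tateModule p)]
    (κ : ZpExtension ℚ p) (γ : absoluteGaloisGroup ℚ) (I : IwasawaH1Data W p κ γ),
    p = 3 → W.HasGoodReductionAtPrime p → ¬ (p : ℤ) ∣ W.frobeniusTrace p →
    W.HasIrreducibleModPGaloisRep p → ¬ W.HasSurjectiveModNGaloisRep p →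
    κ.IsCyclotomic → κ.IsTopGenerator γ →
    (∃ s : I.H, IsEulerSystemClass W p κ γ I s ∧
      s ∉ IwasawaAlgebra.augIdealP p • (⊤ : Submodule (IwasawaAlgebra p) I.H)) →
    ∃ J : ℕ, ∀ y : Literature.NumberTheory.EllipticCurves.subgroupH1 κ.kerSubgroup
        (WeierstrassCurve.geomTorsion W (p : ℤ)),
      W.torsionToPrimaryH1Sub p κ.kerSubgroup y ∈ W.fineSelmerInfty κ →
        (⇑(Literature.NumberTheory.EllipticCurves.conjH1 κ.kerSubgroup
            (WeierstrassCurve.geomTorsion W (p : ℤ)) γ -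
          AddMonoidHom.id (Literature.NumberTheory.EllipticCurves.subgroupH1 κ.kerSubgroup
            (WeierstrassCurve.geomTorsion W (p : ℤ)))))^[J] y = 0

/-! ### `KatoMuTransferThree` from the core and Kato's two construction facts -/

/-- **KERNEL: `Kato2004.nonempty_iwasawaH1Data` ∧ `Kato2004.exists_divisibilityInputs_fineQuotient_zeta`
(PUBLISHED construction facts: Kato 2004 §12.2/(12.2.1), Thm. 12.6 + (14.9.3)/(17.13.1)) ∧
`CoreTheoremAOnClassX10b` ⟹ `KatoMuTransferThree`.** The composition `MuTransferX9_of` of the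
registered skeleton v4 of crux `MuTransferX9` run at `p = 3`: GV Prop. 3.7
(`exists_iwasawaToPowerSeries_eq_padicLFunction`, odd `p`, `E[p]` irreducible) → the unit coefficient
gives `G₁ ∉ (p)` (`not_mem_augIdealP_of_norm_coeff_eq_one`) → package + fine quotient + span clause →
a genuine Euler-system class `∉ p𝐇¹` (`exists_isEulerSystemClass_not_mem`, MU-TRANSFER-PROOF §6 (i))
→ the core → `Sel₀(ℚ_∞, E[p^∞])[p]` finite (`finite_fineSelmerInfty_pTorsion_of_forall_iterate_eq_zero`)
→ `X₀/pX₀` finite (`FineSelmerDualData.finite_quotient_augIdealP_of_finite_pTorsion`) →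
`length_{(p)} X₀ = 0` (`KatoMuSkeleton.lengthAt_eq_zero_of_finite_quotient_p`) → `length_{(p)} X = 0`
(`Kato2004.lengthAt_X_le_lengthAt_fine`) → `D.mu = 0` (`muInvariant_eq_toNat_lengthAt`); `X(E/ℚ_∞)`
is finitely generated over `Λ` by `SelmerDualData.module_finite_of_isCyclotomic` (no torsion
hypothesis). Conditional exactly on the two named construction facts and the typed core.
[cite: Kato2004Asterisque, Thm. 12.6 (p. 222), (14.9.3) (p. 240) and §17.13 (pp. 279–280)]
[cite: GreenbergVatsal2000, Prop. 3.7] -/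
theorem katoMuTransferThree_of_core (hne : nonempty_iwasawaH1Data)
    (hfine : exists_divisibilityInputs_fineQuotient_zeta) (hcore : CoreTheoremAOnClassX10b) :
    KatoMuTransferThree := by
  intro W _ _ p _ N _ f hp3 hgood hap hirr hnsurj hf hcert κ γ hκ hγ hγ' D
  haveI : ContinuousSMul ℤ_[p] (W.tateModule p) := TateModule.continuousSMul_padicInt
  haveI : Module.Free ℤ_[p] (W.tateModule p) := W.module_free_tateModule_holds p
  haveI : Module.Finite ℤ_[p] (W.tateModule p) := W.module_finite_tateModule_holds p
  have hp2 : p ≠ 2 := by omega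
  have hord : IsOrdinaryAt W p := ⟨hgood, hap⟩
  -- the pinned modules: `𝐇¹_Γ(T_pW)` and the dual fine Selmer group `X₀(E/ℚ_∞)`
  obtain ⟨I⟩ := hne W p κ γ hκ hγ
  obtain ⟨Y⟩ := W.nonempty_fineSelmerDualData κ hγ
  -- `X(E/ℚ_∞)` is finitely generated over `Λ` for the cyclotomic `κ` (PROVED in the tree, Nakayama)
  haveI : Module.Finite (IwasawaAlgebra p) D.X :=
    WeierstrassCurve.SelmerDualData.module_finite_of_isCyclotomic W κ hκ D hγ
  -- Kato's package with the fine quotient and the span clause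
  obtain ⟨K, π, hπs, hπ, hZ⟩ := hfine W p f κ γ hp2 hord hκ hγ hγ' hf I D Y
  haveI : Module.Finite (IwasawaAlgebra p) Y.X := Module.Finite.of_surjective π hπs
  -- `L_p ∈ Λ` (GV Prop. 3.7) and the certificate: `G₁ ∉ (p)`
  obtain ⟨G₁, hG₁⟩ := exists_iwasawaToPowerSeries_eq_padicLFunction hp2 hord hf hirr
  have hμL : G₁ ∉ IwasawaAlgebra.augIdealP p := not_mem_augIdealP_of_norm_coeff_eq_one hG₁ hcert
  -- §6 (i) with the Thm. 12.6 span clause: some GENUINE Euler-system class is not divisible by `p`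
  obtain ⟨s, hs, hsp⟩ := exists_isEulerSystemClass_not_mem K hZ hirr hG₁ hμL
  -- the core (typed): a power of `T` kills the `E[p]`-lifts of `Sel₀`
  obtain ⟨J, hJ⟩ := hcore W p κ γ I hp3 hgood hap hirr hnsurj hκ hγ ⟨s, hs, hsp⟩
  haveI : Finite (Y.X ⧸ (IwasawaAlgebra.augIdealP p • (⊤ : Submodule (IwasawaAlgebra p) Y.X))) :=
    Y.finite_quotient_augIdealP_of_finite_pTorsion
      (W.finite_fineSelmerInfty_pTorsion_of_forall_iterate_eq_zero κ hγ hJ)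
  -- bookkeeping at `𝔭 = (p)`: `length X₀_𝔭 = 0 ⟹ length X_𝔭 = 0 ⟹ μ(X) = 0`
  let 𝔭 : PrimeSpectrum (IwasawaAlgebra p) :=
    ⟨IwasawaAlgebra.augIdealP p, IwasawaAlgebra.isPrime_augIdealP_holds p⟩
  have hY0 : Module.lengthAt (IwasawaAlgebra p) Y.X 𝔭 = 0 :=
    Summit.BirchSwinnertonDyer.BirchSwinnertonDyer.Rank1Residual.KatoMuSkeleton.lengthAt_eq_zero_of_finite_quotient_p
      (M := Y.X) 𝔭 rfl
  have hX0 : Module.lengthAt (IwasawaAlgebra p) D.X 𝔭 = 0 :=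
    le_antisymm ((lengthAt_X_le_lengthAt_fine K hirr hG₁ 𝔭
      (by exact IwasawaAlgebra.height_augIdealP_holds p) hμL π hπ).trans hY0.le) bot_le
  change muInvariant p D.X = 0
  rw [muInvariant_eq_toNat_lengthAt p D.X 𝔭 rfl, hX0]
  rfl

/-! ### The A5 chain re-based on the core -/

/-- **X_A3 on class X10b from the core**: Yan–Zhu 2026 Thm. 4.9 (`hYZ`, PUB, flag
`YZ26@3-BF-ERL-Ohta`) ∧ period units (`h5`, `h3`) ∧ modularity (`hmodP`) ∧ Kato's two construction
facts (`hne`, `hfine`) ∧ `CoreTheoremAOnClassX10b` ∧ `AnalyticMuZeroOnClassX10b` ⟹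
`MazurMainConjectureOnClassX10b` (GEN 35's `mazurMainConjectureOnClassX10b_of_katoMuTransferThree` ∘
`katoMuTransferThree_of_core`). The flag rides with the conclusion; nothing booked.
[cite: YanZhu2024MainConjNonCM, Thm. 4.9 (§4.4)] [cite: Kato2004Asterisque, Thm. 12.6 (p. 222) and §17.13 (pp. 279–280)]
[cite: GreenbergVatsal2000, Prop. 3.7] -/
theorem mazurMainConjectureOnClassX10b_of_core
    (hYZ : YanZhu2026.thm49_charIdeal_eq_padicLFunction)
    (h5 : realPeriodRat_eq_unit_mul_plusPeriod) (h3 : realPeriodRat_eq_unit_mul_plusPeriod_three)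
    (hmodP : nonempty_modularParametrizationData)
    (hne : nonempty_iwasawaH1Data) (hfine : exists_divisibilityInputs_fineQuotient_zeta)
    (hcore : CoreTheoremAOnClassX10b) (hA : AnalyticMuZeroOnClassX10b) :
    MazurMainConjectureOnClassX10b :=
  mazurMainConjectureOnClassX10b_of_katoMuTransferThree hYZ h5 h3 hmodP
    (katoMuTransferThree_of_core hne hfine hcore) hA

/-- **The class leaf of row A5 from the core (KERNEL bridge; the K6′ composition in waiting).**
PUBLISHED binders: Yan–Zhu 2026 Thm. 4.9 (`hYZ`, flag `YZ26@3-BF-ERL-Ohta`), Greenberg LNM 1716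
Thm. 4.1 (`hGr`), the period units (`h5`, `h3`), Perrin-Riou–Schneider (`hS`), Perrin-Riou 1987 (`hPR`),
the Mazur–Tate σ (`hMT`), modularity (`hmodP`), Gross–Zagier–Kolyvagin (`hGZK`), and Kato's two
CONSTRUCTION facts (`hne` = §12.2 `𝐇¹_Γ(T_pW)` exists, `hfine` = Thm. 12.6 + (14.9.3)/(17.13.1)
package). OPEN inputs, typed: `CoreTheoremAOnClassX10b` (the cell theorem of `bsd-smallim` on paper, at
`p = 3`), `AnalyticMuZeroOnClassX10b` (Greenberg's Conj. 1.11, analytic side — barrier B3; certified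
per pair on 313/313 census cells, two engines), and the Schneider rider at the rank-`1` pairs (`hC3`,
rider I1). Conclusion: `BSDpOnClassX10b`. Nothing is booked; the label of N2 does not move.
[cite: YanZhu2024MainConjNonCM, Thm. 4.9 (§4.4)] [cite: GreenbergLNM1716, Thm. 4.1 (p. 102) and §1 Conj. 1.11]
[cite: Kato2004Asterisque, Thm. 12.6 (p. 222), (14.9.3) (p. 240) and §17.13 (pp. 279–280)]
[cite: PerrinRiou1987, §1.4 Cor. 1.8] [cite: Miller2011LMS, §1 and Def. 1.1] -/
theorem bsdpOnClassX10b_of_core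
    (hYZ : YanZhu2026.thm49_charIdeal_eq_padicLFunction)
    (hGr : greenberg_charValue_rankZero) (h5 : realPeriodRat_eq_unit_mul_plusPeriod)
    (h3 : realPeriodRat_eq_unit_mul_plusPeriod_three)
    (hS : Schneider1985_order_charGenerator_odd) (hPR : perrinRiou_rankOne_leadingTerms_odd)
    (hMT : mazur_tate_sigma_exists_odd) (hmodP : nonempty_modularParametrizationData)
    (hGZK : rank_eq_analyticRank_of_analyticRank_le_one)
    (hne : nonempty_iwasawaH1Data) (hfine : exists_divisibilityInputs_fineQuotient_zeta)
    (hcore : CoreTheoremAOnClassX10b) (hA : AnalyticMuZeroOnClassX10b)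
    (hC3 : ∀ (W : WeierstrassCurve ℚ) [W.IsElliptic] [W.IsGloballyMinimal] (p : ℕ) [Fact p.Prime],
      ClassX10 W p → ¬ Surj W 3 → W.analyticRank = 1 →
        ∀ Dh : PAdicHeightData W p, Dh.IsCanonical → SchneiderConjecture Dh) :
    BSDpOnClassX10b :=
  bsdpOnClassX10b_of_katoMuTransferThree hYZ hGr h5 h3 hS hPR hMT hmodP hGZK
    (katoMuTransferThree_of_core hne hfine hcore) hA hC3

end Summit.BirchSwinnertonDyer.Rank1Residual.X10

end
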